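import Summits.BirchSwinnertonDyer.BirchSwinnertonDyer.Theorems.ByReductionTypeAtTwoFlatWitnessPrime
import HarnessLib

/-!
# Route `ByReductionTypeAtTwo` (K4), crux `OrdMissingLowerBoundAtTwo` (stmt-BirchSwinnertonDyer-19577), line
# `kato-free-lower-sandwich-two` — the flat witness (W) at every odd level where `−1` is NOT a square
# (`--supports`, helper; prepares skeleton v10: the registered stub `stub_flatWitnessAtTwoComposite` shrinks to the levels whose
# prime factors are all `≡ 1 (mod 4)`)

Cell `bsd-2adic`, lead `cruxlead-stmt-BirchSwinnertonDyer-19577` (g2).  THEOREMS ONLY — no definition, no named fact, no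
`sorry`; closes nothing; BSD is not proved by any of this.

* §1 the torsion theorem of `ByReductionTypeAtTwoSL2ZTorsion` refined: an element of finite order of `SL(2, ℤ)` has
  `(tr γ)² ≤ 1` or is `±1` (`trace_sq_le_one_or_eq_of_isOfFinOrder`); hence the lower-right entry `d` of a KILLED element of
  `Γ₀(N)` (finite order or trace `±2`) satisfies, mod `N`, one of `(d ∓ 1)² = 0`, `d² + 1 = 0`, `d² ∓ d + 1 = 0`
  (`gamma0Map_cases_of_killed`, from `d² − tr(γ)·d + 1 ≡ 0`), and therefore `d^N = ±1` (binomial theorem with `(d ∓ 1)² = 0`: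
  `(1 + x)^N = 1 + N·x`), `d³ = ±1`, or `d² = −1`.
* §2 `flatWitnessAtTwo_of_not_isSquare_neg_one`: if `−1` is not a square mod `N` (e.g. `N` has a prime factor `≡ 3 (mod 4)`), the
  order-`4` case is absent, so `H₋ = {u : u^{3N} = ±1} ≤ (ℤ/N)ˣ` is ADMISSIBLE; with `k` the order of `2` in `(ℤ/N)ˣ/±1` the
  parabolic element `(±2 − 2ᵏ, −1; (2ᵏ ∓ 1)², 2ᵏ)` is the witness, and `2ᵉ ∈ H₋ ⟹ k ∣ 3N·e ⟹ gcd(k, 4) ∣ e` (`3N` odd).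
  `flatWitnessAtTwo_of_residual` reduces the registered stub to the composite odd levels `N > 1` with `−1` a square mod `N` (all prime
  factors `≡ 1 (mod 4)`) — the family carrying the 196 product-witness levels `≤ 30000` of crux-triage r1-2 §N2.
-/

set_option linter.dupNamespace false
set_option autoImplicit false

namespace Summit.BirchSwinnertonDyer.BirchSwinnertonDyer.Theorems.FlatWitnessTwo

open scoped MatrixGroups
open CongruenceSubgroup Literature.NumberTheory.EllipticCurves.Rank1Residual
  Literature.NumberTheory.EllipticCurves.ModularForms

/-! ## §1 Killed elements of `Γ₀(N)`: the lower-right entry mod `N` -/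

section Killed

/-- **Finite order in `SL(2, ℤ)` ⟹ `(tr γ)² ≤ 1` or `γ = ±1`** (hyperbolic traces grow: `abs_trace_pow_lt_succ`; a unipotent of
finite order is trivial: `eq_one_of_trace_eq_two_of_pow_eq_one`). [cite: DiamondShurman2005, Exercise 2.3.7 (a)] -/
theorem trace_sq_le_one_or_eq_of_isOfFinOrder (γ : SL(2, ℤ)) (hγ : IsOfFinOrder γ) :
    (γ 0 0 + γ 1 1) ^ 2 ≤ 1 ∨ γ = 1 ∨ γ = -1 := by
  obtain ⟨n, hn, hγn⟩ := hγ.exists_pow_eq_one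
  set t : ℤ := γ 0 0 + γ 1 1 with ht_def
  by_cases hsmall : t ^ 2 ≤ 1
  · exact Or.inl hsmall
  right
  rcases le_or_gt 3 |t| with hbig | hmid
  · exfalso
    have hge : ∀ m : ℕ, 3 ≤ |(γ ^ (m + 1) : SL(2, ℤ)) 0 0 + (γ ^ (m + 1) : SL(2, ℤ)) 1 1| := by
      intro m
      induction m with
      | zero => simpa using hbig
      | succ m ih => exact le_trans ih (le_of_lt (abs_trace_pow_lt_succ γ hbig (m + 1)))
    obtain ⟨m, rfl⟩ := Nat.exists_eq_succ_of_ne_zero hn.ne'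
    have h := hge m
    rw [Nat.succ_eq_add_one] at hγn
    rw [hγn] at h
    have h2 : |((1 : SL(2, ℤ)) 0 0 : ℤ) + (1 : SL(2, ℤ)) 1 1| = 2 := by simp
    rw [h2] at h
    omega
  · have hlt : -3 < t ∧ t < 3 := abs_lt.mp hmid
    have ht2 : t = 2 ∨ t = -2 := by
      have hout : ¬ (-1 ≤ t ∧ t ≤ 1) := by
        rintro ⟨h1, h2⟩
        exact hsmall (by nlinarith)
      omega
    rcases ht2 with h | h
    · exact Or.inl (eq_one_of_trace_eq_two_of_pow_eq_one γ h hn hγn)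
    · right
      have hneg : (-γ : SL(2, ℤ)) 0 0 + (-γ : SL(2, ℤ)) 1 1 = 2 := by
        have e0 : ((-γ : SL(2, ℤ)) 0 0 : ℤ) = -(γ 0 0) := by
          rw [Matrix.SpecialLinearGroup.coe_neg]; rfl
        have e1 : ((-γ : SL(2, ℤ)) 1 1 : ℤ) = -(γ 1 1) := by
          rw [Matrix.SpecialLinearGroup.coe_neg]; rfl
        rw [e0, e1]
        linarith
      have hpow : (-γ) ^ (2 * n) = 1 := by
        rw [pow_mul, neg_sq, ← pow_mul, mul_comm, pow_mul, hγn, one_pow]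
      have h1 := eq_one_of_trace_eq_two_of_pow_eq_one (-γ) hneg (by omega) hpow
      rw [← neg_neg γ, h1]

/-- `d² − tr(γ)·d + 1 ≡ 0 (mod N)` for `γ = (a b; c d) ∈ Γ₀(N)`: `ad ≡ 1` and `a = tr − d`. [folklore] -/
theorem gamma0Map_sq_sub_tr_mul_add_one {N : ℕ} (γ : Gamma0 N) :
    Gamma0Map N γ ^ 2 - ((trEntry γ : ℤ) : ZMod N) * Gamma0Map N γ + 1 = 0 := by
  have hdet : ((γ : SL(2, ℤ)) 0 0 : ℤ) * (γ : SL(2, ℤ)) 1 1 - ((γ : SL(2, ℤ)) 0 1 : ℤ) * (γ : SL(2, ℤ)) 1 0 = 1 := by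
    have := Matrix.SpecialLinearGroup.det_coe (γ : SL(2, ℤ))
    rw [Matrix.det_fin_two] at this
    linear_combination this
  have hc : (((γ : SL(2, ℤ)) 1 0 : ℤ) : ZMod N) = 0 := Gamma0_mem.mp γ.2
  have hd : Gamma0Map N γ = (((γ : SL(2, ℤ)) 1 1 : ℤ) : ZMod N) := rfl
  have hdetN : (((γ : SL(2, ℤ)) 0 0 : ℤ) : ZMod N) * (((γ : SL(2, ℤ)) 1 1 : ℤ) : ZMod N) = 1 := by
    have := congrArg (fun z : ℤ => (z : ZMod N)) hdet
    simp only [Int.cast_sub, Int.cast_mul, Int.cast_one, hc, mul_zero, sub_zero] at this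
    exact this
  rw [hd, trEntry]
  push_cast
  linear_combination -hdetN

/-- **The lower-right entry of a KILLED element of `Γ₀(N)`** (finite order or trace `±2`) satisfies, mod `N`,
`(d − 1)² = 0 ∨ (d + 1)² = 0 ∨ d² + 1 = 0 ∨ d² − d + 1 = 0 ∨ d² + d + 1 = 0` (traces `2, −2, 0, 1, −1`).
[cite: Manin1972, Prop. 1.4] -/
theorem gamma0Map_cases_of_killed {N : ℕ} (γ : Gamma0 N) (hγ : IsOfFinOrder γ ∨ trEntry γ = 2 ∨ trEntry γ = -2) :
    (Gamma0Map N γ - 1) ^ 2 = 0 ∨ (Gamma0Map N γ + 1) ^ 2 = 0 ∨ Gamma0Map N γ ^ 2 + 1 = 0 ∨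
      Gamma0Map N γ ^ 2 - Gamma0Map N γ + 1 = 0 ∨ Gamma0Map N γ ^ 2 + Gamma0Map N γ + 1 = 0 := by
  have hq := gamma0Map_sq_sub_tr_mul_add_one γ
  set d : ZMod N := Gamma0Map N γ with hd
  -- trace `2` / `-2`
  have htr2 : trEntry γ = 2 → (d - 1) ^ 2 = 0 := fun h => by
    rw [h] at hq; push_cast at hq; linear_combination hq
  have htrm2 : trEntry γ = -2 → (d + 1) ^ 2 = 0 := fun h => by
    rw [h] at hq; push_cast at hq; linear_combination hq
  rcases hγ with hfin | h2 | hm2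
  · rcases trace_sq_le_one_or_eq_of_isOfFinOrder (γ : SL(2, ℤ)) ((Gamma0 N).subtype.isOfFinOrder hfin) with ht | h1 | h1
    · -- `tr ∈ {0, 1, -1}`
      have htr : trEntry γ = 0 ∨ trEntry γ = 1 ∨ trEntry γ = -1 := by
        have hb : -1 ≤ trEntry γ ∧ trEntry γ ≤ 1 := by
          unfold trEntry
          constructor <;> nlinarith [ht]
        omega
      rcases htr with h | h | h <;> rw [h] at hq <;> push_cast at hq
      · exact Or.inr (Or.inr (Or.inl (by linear_combination hq)))
      · exact Or.inr (Or.inr (Or.inr (Or.inl (by linear_combination hq))))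
      · exact Or.inr (Or.inr (Or.inr (Or.inr (by linear_combination hq))))
    · have : trEntry γ = 2 := by
        have e : (γ : SL(2, ℤ)) = 1 := h1
        unfold trEntry; rw [e]; simp
      exact Or.inl (htr2 this)
    · have : trEntry γ = -2 := by
        have e : (γ : SL(2, ℤ)) = -1 := h1
        unfold trEntry; rw [e]; simp [Matrix.SpecialLinearGroup.coe_neg]
      exact Or.inr (Or.inl (htrm2 this))
  · exact Or.inl (htr2 h2)
  · exact Or.inr (Or.inl (htrm2 hm2))

/-- Binomial theorem for a square-zero element: `(1 + x)ⁿ = 1 + n·x` when `x² = 0`. [folklore] -/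
theorem one_add_pow_of_sq_eq_zero {R : Type*} [CommRing R] (x : R) (hx : x ^ 2 = 0) (n : ℕ) :
    (1 + x) ^ n = 1 + (n : R) * x := by
  induction n with
  | zero => simp
  | succ n ih =>
    rw [pow_succ, ih]
    push_cast
    linear_combination (n : R) * hx

/-- In `ℤ/N`: `(d − 1)² = 0 ⟹ d^N = 1` (`(1 + x)^N = 1 + N·x = 1`). [folklore] -/
theorem pow_eq_one_of_sub_one_sq {N : ℕ} (d : ZMod N) (h : (d - 1) ^ 2 = 0) : d ^ N = 1 := by
  have := one_add_pow_of_sq_eq_zero (d - 1) h N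
  rw [add_sub_cancel, ZMod.natCast_self, zero_mul, add_zero] at this
  exact this

/-- In `ℤ/N`, `N` odd: `(d + 1)² = 0 ⟹ d^N = −1`. [folklore] -/
theorem pow_eq_neg_one_of_add_one_sq {N : ℕ} (hN : Odd N) (d : ZMod N) (h : (d + 1) ^ 2 = 0) : d ^ N = -1 := by
  have h' : (-d - 1) ^ 2 = 0 := by linear_combination h
  have h1 := pow_eq_one_of_sub_one_sq (-d) h'
  rw [hN.neg_pow] at h1
  linear_combination -h1

/-- **For a killed `γ ∈ Γ₀(N)`, `N` odd, with `−1` NOT a square mod `N`: `d(γ)^{3N} ≡ ±1 (mod N)`.** [cite: Manin1972, Prop. 1.4] -/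
theorem gamma0Map_pow_three_mul_of_killed {N : ℕ} (hN : Odd N) (hsq : ¬ IsSquare (-1 : ZMod N)) (γ : Gamma0 N)
    (hγ : IsOfFinOrder γ ∨ trEntry γ = 2 ∨ trEntry γ = -2) :
    Gamma0Map N γ ^ (3 * N) = 1 ∨ Gamma0Map N γ ^ (3 * N) = -1 := by
  rcases gamma0Map_cases_of_killed γ hγ with h | h | h | h | h
  · left; rw [mul_comm, pow_mul, pow_eq_one_of_sub_one_sq _ h, one_pow]
  · right; rw [mul_comm, pow_mul, pow_eq_neg_one_of_add_one_sq hN _ h]; norm_num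
  · exact absurd ⟨Gamma0Map N γ, by linear_combination -h⟩ hsq
  · right
    have h3 : Gamma0Map N γ ^ 3 = -1 := by linear_combination (Gamma0Map N γ + 1) * h
    rw [pow_mul, h3, hN.neg_one_pow]
  · left
    have h3 : Gamma0Map N γ ^ 3 = 1 := by linear_combination (Gamma0Map N γ - 1) * h
    rw [pow_mul, h3, one_pow]

end Killed

/-! ## §2 The flat witness where `−1` is not a square -/

section Nonsquare

/-- **(W) at every odd level where `−1` is not a square mod `N`.**  `H₋ = {u : u^{3N} = ±1}` is admissible
(`gamma0Map_pow_three_mul_of_killed`); `k` = order of `2` in `(ℤ/N)ˣ/±1`, so `2ᵏ ≡ ±1 (mod N)` and the parabolic element with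
`d = 2ᵏ` (`exists_parabolic_dEntry`) is the witness; `2ᵉ ∈ H₋ ⟹ k ∣ 3N·e ⟹ gcd(k, 4) ∣ e`. [cite: Manin1972, Prop. 1.4] -/
theorem flatWitnessAtTwo_of_not_isSquare_neg_one (N : ℕ) (hN : Odd N) (hsq : ¬ IsSquare (-1 : ZMod N)) :
    ∃ (H : Subgroup (ZMod N)ˣ) (ρ : Gamma0 N) (k : ℕ), -1 ∈ H ∧
      (∀ γ : Gamma0 N, IsOfFinOrder γ ∨ trEntry γ = 2 ∨ trEntry γ = -2 → ∃ u ∈ H, (u : ZMod N) = Gamma0Map N γ) ∧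
      ρ ∈ Subgroup.closure {γ : Gamma0 N | IsOfFinOrder γ ∨ trEntry γ = 2 ∨ trEntry γ = -2} ⊔ commutator (Gamma0 N) ∧
      (dEntry ρ).natAbs = 2 ^ k ∧
      ∀ e : ℕ, (∃ u ∈ H, (u : ZMod N) = 2 ^ e) → Nat.gcd k 4 ∣ e := by
  haveI : NeZero N := ⟨hN.pos.ne'⟩
  have h3N : Odd (3 * N) := (by decide : Odd 3).mul hN
  -- `C = {±1}`, `H₋ = {u : u^{3N} ∈ C}`
  set C : Subgroup (ZMod N)ˣ := Subgroup.closure {(-1 : (ZMod N)ˣ)} with hCdef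
  have hmemC : ∀ u : (ZMod N)ˣ, u ∈ C ↔ u = 1 ∨ u = -1 := by
    intro u
    rw [hCdef, Subgroup.mem_closure_singleton]
    constructor
    · rintro ⟨n, rfl⟩
      rcases Int.even_or_odd n with he | ho
      · exact Or.inl he.neg_one_zpow
      · exact Or.inr ho.neg_one_zpow
    · rintro (rfl | rfl)
      · exact ⟨0, by simp⟩
      · exact ⟨1, by simp⟩
  set H : Subgroup (ZMod N)ˣ := C.comap (powMonoidHom (3 * N)) with hHdef
  have hmemH : ∀ u : (ZMod N)ˣ, u ∈ H ↔ u ^ (3 * N) = 1 ∨ u ^ (3 * N) = -1 := by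
    intro u
    rw [hHdef, Subgroup.mem_comap, powMonoidHom_apply, hmemC]
  have hneg : -1 ∈ H := by
    rw [hmemH]
    exact Or.inr h3N.neg_one_pow
  have hH : ∀ γ : Gamma0 N, IsOfFinOrder γ ∨ trEntry γ = 2 ∨ trEntry γ = -2 →
      ∃ u ∈ H, (u : ZMod N) = Gamma0Map N γ := by
    intro γ hγ
    obtain ⟨u, hu⟩ := isUnit_Gamma0Map N γ
    refine ⟨u, ?_, hu⟩
    rw [hmemH]
    rcases gamma0Map_pow_three_mul_of_killed hN hsq γ hγ with h | h
    · left; ext; rw [Units.val_pow_eq_pow_val, hu, h, Units.val_one]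
    · right; ext; rw [Units.val_pow_eq_pow_val, hu, h, Units.val_neg, Units.val_one]
  -- the unit `2` and its order `k` modulo `±1`
  have hcop : Nat.Coprime 2 N := Nat.coprime_two_left.mpr hN
  set t : (ZMod N)ˣ := ZMod.unitOfCoprime 2 hcop with htdef
  have ht : (t : ZMod N) = 2 := by rw [htdef, ZMod.coe_unitOfCoprime]; norm_num
  set q : (ZMod N)ˣ →* (ZMod N)ˣ ⧸ C := QuotientGroup.mk' C with hqdef
  set k : ℕ := orderOf (q t) with hkdef
  have hk : 0 < k := orderOf_pos (q t)
  have htk : t ^ k ∈ C := by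
    rw [← QuotientGroup.eq_one_iff, ← QuotientGroup.mk'_apply, ← hqdef, map_pow]
    exact pow_orderOf_eq_one (q t)
  have hkey : ∀ e : ℕ, (∃ u ∈ H, (u : ZMod N) = 2 ^ e) → Nat.gcd k 4 ∣ e := by
    rintro e ⟨u, huH, hu⟩
    have hut : u = t ^ e := Units.ext (by rw [hu, Units.val_pow_eq_pow_val, ht])
    rw [hut, hHdef, Subgroup.mem_comap, powMonoidHom_apply, ← pow_mul] at huH
    have h1 : (q t) ^ (e * (3 * N)) = 1 := by
      rw [← map_pow, hqdef, QuotientGroup.mk'_apply, QuotientGroup.eq_one_iff]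
      exact huH
    have hdvd : k ∣ e * (3 * N) := orderOf_dvd_of_pow_eq_one h1
    have h4 : Nat.gcd k 4 ∣ 4 := Nat.gcd_dvd_right k 4
    have hc4 : Nat.Coprime 4 (3 * N) := by
      have h2 : Nat.Coprime 2 (3 * N) := Nat.coprime_two_left.mpr h3N
      simpa using h2.pow_left 2
    have hc : Nat.Coprime (Nat.gcd k 4) (3 * N) := Nat.Coprime.coprime_dvd_left h4 hc4
    exact hc.dvd_of_dvd_mul_right ((Nat.gcd_dvd_left k 4).trans hdvd)
  -- the parabolic witness with `d = 2^k`
  set D : ℤ := (2 : ℤ) ^ k with hDdef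
  have hDabs : D.natAbs = 2 ^ k := by rw [hDdef, Int.natAbs_pow]; rfl
  have hDt : ((D : ℤ) : ZMod N) = (t ^ k : (ZMod N)ˣ) := by
    rw [hDdef, Units.val_pow_eq_pow_val, ht]; push_cast; rfl
  rcases (hmemC _).mp htk with h1 | h1
  · -- `2^k ≡ 1`: parabolic of trace `2`
    have hx : (((D - 1 : ℤ)) : ZMod N) = 0 := by push_cast; rw [hDt, h1, Units.val_one, sub_self]
    have hsq : (N : ℤ) ∣ (D - 1) ^ 2 := Dvd.dvd.pow ((ZMod.intCast_zmod_eq_zero_iff_dvd _ N).mp hx) two_ne_zero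
    obtain ⟨ρ, hρtr, hρd⟩ := exists_parabolic_dEntry N D 1 (Or.inl rfl) hsq
    exact flatWitnessAt_of_single H hneg hH ρ (Or.inr (Or.inl (by rw [hρtr]; norm_num))) k
      (by rw [hρd, hDabs]) hkey
  · -- `2^k ≡ -1`: parabolic of trace `-2`
    have hx : (((D - (-1) : ℤ)) : ZMod N) = 0 := by
      push_cast; rw [hDt, h1, Units.val_neg, Units.val_one]; ring
    have hsq : (N : ℤ) ∣ (D - (-1)) ^ 2 := Dvd.dvd.pow ((ZMod.intCast_zmod_eq_zero_iff_dvd _ N).mp hx) two_ne_zero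
    obtain ⟨ρ, hρtr, hρd⟩ := exists_parabolic_dEntry N D (-1) (Or.inr rfl) hsq
    exact flatWitnessAt_of_single H hneg hH ρ (Or.inr (Or.inr (by rw [hρtr]; norm_num))) k
      (by rw [hρd, hDabs]) hkey

/-- **(W) reduces to the composite odd levels `N > 1` with `−1` a square mod `N`** (equivalently: every prime factor `≡ 1 (mod 4)`):
prime levels by `flatWitnessAtTwo_prime`, `N = 1` by `flatWitnessAtTwo_one`, nonsquare levels by
`flatWitnessAtTwo_of_not_isSquare_neg_one`. [cite: Manin1972, Prop. 1.4] -/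
theorem flatWitnessAtTwo_of_residual
    (hres : ∀ N : ℕ, Odd N → 1 < N → ¬ N.Prime → IsSquare (-1 : ZMod N) →
      ∃ (H : Subgroup (ZMod N)ˣ) (ρ : Gamma0 N) (k : ℕ), -1 ∈ H ∧
      (∀ γ : Gamma0 N, IsOfFinOrder γ ∨ trEntry γ = 2 ∨ trEntry γ = -2 → ∃ u ∈ H, (u : ZMod N) = Gamma0Map N γ) ∧
      ρ ∈ Subgroup.closure {γ : Gamma0 N | IsOfFinOrder γ ∨ trEntry γ = 2 ∨ trEntry γ = -2} ⊔ commutator (Gamma0 N) ∧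
      (dEntry ρ).natAbs = 2 ^ k ∧
      ∀ e : ℕ, (∃ u ∈ H, (u : ZMod N) = 2 ^ e) → Nat.gcd k 4 ∣ e) :
    ∀ N : ℕ, Odd N →
      ∃ (H : Subgroup (ZMod N)ˣ) (ρ : Gamma0 N) (k : ℕ), -1 ∈ H ∧
      (∀ γ : Gamma0 N, IsOfFinOrder γ ∨ trEntry γ = 2 ∨ trEntry γ = -2 → ∃ u ∈ H, (u : ZMod N) = Gamma0Map N γ) ∧
      ρ ∈ Subgroup.closure {γ : Gamma0 N | IsOfFinOrder γ ∨ trEntry γ = 2 ∨ trEntry γ = -2} ⊔ commutator (Gamma0 N) ∧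
      (dEntry ρ).natAbs = 2 ^ k ∧
      ∀ e : ℕ, (∃ u ∈ H, (u : ZMod N) = 2 ^ e) → Nat.gcd k 4 ∣ e := by
  refine flatWitnessAtTwo_of_composite (fun N hN h1 hP => ?_)
  by_cases hsq : IsSquare (-1 : ZMod N)
  · exact hres N hN h1 hP hsq
  · exact flatWitnessAtTwo_of_not_isSquare_neg_one N hN hsq

end Nonsquare

end Summit.BirchSwinnertonDyer.BirchSwinnertonDyer.Theorems.FlatWitnessTwo
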